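import Summits.MatrixMultiplication.OmegaCensus.STPP222SqFrom24
import Summits.MatrixMultiplication.OmegaCensus.STPP222PentaOrder72
import Summits.MatrixMultiplication.OmegaCensus.STPPSumsetPacking

/-!
# ω-census, the pattern `(2,2,2)¹` (one TPP triple of 2-subsets): exactly the finite abelian groups of order `≥ 8` other than `ℤ/3 × ℤ/3`

HONEST FRAMING (pub-omega census; verbatim): lottery ticket; floor = certified bounds/negative ranges.
Census STRUCTURE bookkeeping (question Q7, row `k = 1` of the threshold functions `n_k`, `N_k`), not progress on `ω`: a single
TPP triple of 2-subsets realises `⟨2,2,2⟩` and yields nothing of interest.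

Both halves are KERNEL theorems here (the first census cell with an infeasibility statement in the kernel):
* `exists_isSTPP_222one_of_card_ne` — every finite abelian `G` with `8 ≤ |G|`, `|G| ≠ 9` admits `A B C : Fin 1 → Finset G` of
  cardinality `2` with `IsSTPP A B C` (i.e. a TPP triple of 2-subsets); `exists_isSTPP_222one_zmod9` — so does `ℤ/9`; hence
  `exists_isSTPP_222one_of_card` — every finite abelian group of order `≥ 10` (`N₁ ≤ 10`);
* `not_exists_isSTPP_222one_of_card_lt` — no finite abelian group of order `< 8` does (`|A||B||C| ≤ |G|`,
  `stpp_card_mul_card_mul_card_le`); `not_exists_isSTPP_222one_z3z3` — `ℤ/3 × ℤ/3` does not (a `decide` over the difference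
  vectors: for all nonzero `a b c ∈ (ℤ/3)²` some signed combination `±a ± b ± c`-type word vanishes nontrivially).
So `n₁ = 8` and `N₁ = 10`, the only abelian group of order `≥ 8` without a TPP triple of 2-subsets being `(ℤ/3)²` (every abelian
group of order `9` and exponent `3` is isomorphic to it; that identification is not restated here).

Proof of the positive half — the reduction of `STPP222CubeFrom46.lean` / `STPP222SqFrom24.lean` with constants changed:
exponent `≥ 8` ⇒ `exists_isSTPP_222pow_of_exponent 1`; exponent `E ≤ 7` ⇒ structure theorem, multiset of prime powers `≤ 7`
dividing `E` with product `≥ 8`, `≠ 9` ⇒ kernel-decided domination (`dom_of_capped8`, caps with `v ^ c ≥ 10`) of one of the 7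
seeds `(ℤ/2)³` (`exists_isSTPP_222pow1_seed_2_2_2` of `STPP222PentaOrder72.lean`), `ℤ/2×ℤ/4, (ℤ/2)²×ℤ/3, ℤ/2×(ℤ/3)², (ℤ/5)², (ℤ/3)³, (ℤ/7)²` ⇒ `exists_emb_of_dom` + `IsSTPP.image`.

References: H. Cohn, R. Kleinberg, B. Szegedy, C. Umans, FOCS 2005 (arXiv:math/0511460), Def. 5.1; H. Cohn, C. Umans, FOCS 2003
(the abelian volume bound).  Record: pub-omega HOME `pub-omega-eng2/results/c4red/K2-THRESHOLD-eng2.md` §K1 (ENG2 gen 16, 2026-08-23).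
-/

open Literature.Computability.AlgebraicComplexity Finset

namespace Summit.MatrixMultiplication.OmegaCensus

/-! ## 1. Seeds and the combinatorial core -/

/-- The seed `ℤ/2 × ℤ/4` (order 8) admits a TPP triple of 2-subsets (kernel-checked). [cite: CohnKleinbergSzegedyUmans2005, Def. 5.1] -/
theorem exists_isSTPP_222one_seed_2_4 :
    ∃ A B C : Fin 1 → Finset (ZMod 2 × ZMod 4), IsSTPP A B C ∧ ∀ i, (A i).card = 2 ∧ (B i).card = 2 ∧ (C i).card = 2 :=
  exists_isSTPP_222pow_of_lists (H := ZMod 2 × ZMod 4) ![[(0, 0), (1, 0)]] ![[(0, 0), (0, 1)]] ![[(0, 0), (0, 2)]]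
    (by decide +kernel) (by decide +kernel)

/-- The seed `ℤ/2 × ℤ/2 × ℤ/3` (order 12) admits a TPP triple of 2-subsets (kernel-checked). [cite: CohnKleinbergSzegedyUmans2005, Def. 5.1] -/
theorem exists_isSTPP_222one_seed_2_2_3 :
    ∃ A B C : Fin 1 → Finset (ZMod 2 × ZMod 2 × ZMod 3), IsSTPP A B C ∧ ∀ i, (A i).card = 2 ∧ (B i).card = 2 ∧ (C i).card = 2 :=
  exists_isSTPP_222pow_of_lists (H := ZMod 2 × ZMod 2 × ZMod 3) ![[(0, 0, 0), (0, 1, 0)]] ![[(0, 0, 0), (0, 0, 1)]] ![[(0, 0, 0), (1, 0, 0)]]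
    (by decide +kernel) (by decide +kernel)

/-- The seed `ℤ/2 × ℤ/3 × ℤ/3` (order 18) admits a TPP triple of 2-subsets (kernel-checked). [cite: CohnKleinbergSzegedyUmans2005, Def. 5.1] -/
theorem exists_isSTPP_222one_seed_2_3_3 :
    ∃ A B C : Fin 1 → Finset (ZMod 2 × ZMod 3 × ZMod 3), IsSTPP A B C ∧ ∀ i, (A i).card = 2 ∧ (B i).card = 2 ∧ (C i).card = 2 :=
  exists_isSTPP_222pow_of_lists (H := ZMod 2 × ZMod 3 × ZMod 3) ![[(0, 0, 0), (1, 0, 0)]] ![[(0, 0, 0), (0, 0, 1)]] ![[(0, 0, 0), (0, 1, 0)]]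
    (by decide +kernel) (by decide +kernel)

/-- The seed `ℤ/5 × ℤ/5` (order 25) admits a TPP triple of 2-subsets (kernel-checked). [cite: CohnKleinbergSzegedyUmans2005, Def. 5.1] -/
theorem exists_isSTPP_222one_seed_5_5 :
    ∃ A B C : Fin 1 → Finset (ZMod 5 × ZMod 5), IsSTPP A B C ∧ ∀ i, (A i).card = 2 ∧ (B i).card = 2 ∧ (C i).card = 2 :=
  exists_isSTPP_222pow_of_lists (H := ZMod 5 × ZMod 5) ![[(0, 0), (0, 1)]] ![[(0, 0), (0, 2)]] ![[(0, 0), (1, 0)]]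
    (by decide +kernel) (by decide +kernel)

/-- The seed `ℤ/3 × ℤ/3 × ℤ/3` (order 27) admits a TPP triple of 2-subsets (kernel-checked). [cite: CohnKleinbergSzegedyUmans2005, Def. 5.1] -/
theorem exists_isSTPP_222one_seed_3_3_3 :
    ∃ A B C : Fin 1 → Finset (ZMod 3 × ZMod 3 × ZMod 3), IsSTPP A B C ∧ ∀ i, (A i).card = 2 ∧ (B i).card = 2 ∧ (C i).card = 2 :=
  exists_isSTPP_222pow_of_lists (H := ZMod 3 × ZMod 3 × ZMod 3) ![[(0, 0, 0), (0, 0, 1)]] ![[(0, 0, 0), (0, 1, 0)]] ![[(0, 0, 0), (1, 0, 0)]]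
    (by decide +kernel) (by decide +kernel)

/-- The seed `ℤ/7 × ℤ/7` (order 49) admits a TPP triple of 2-subsets (kernel-checked). [cite: CohnKleinbergSzegedyUmans2005, Def. 5.1] -/
theorem exists_isSTPP_222one_seed_7_7 :
    ∃ A B C : Fin 1 → Finset (ZMod 7 × ZMod 7), IsSTPP A B C ∧ ∀ i, (A i).card = 2 ∧ (B i).card = 2 ∧ (C i).card = 2 :=
  exists_isSTPP_222pow_of_lists (H := ZMod 7 × ZMod 7) ![[(0, 0), (0, 1)]] ![[(0, 0), (0, 2)]] ![[(0, 0), (1, 0)]]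
    (by decide +kernel) (by decide +kernel)

/-- A `(2,2,2)¹` seed: moduli with a kernel proof that `ℤ/s₁ × ⋯ × ℤ/s_k` (`SeedType s`) admits a TPP triple of 2-subsets.
[cite: CohnKleinbergSzegedyUmans2005, Def. 5.1] -/
structure Seed1 where
  /-- the moduli, in the order of the seed theorem's product type -/
  s : List ℕ
  /-- the product group admits the STPP pattern `(2,2,2)¹` -/
  ok : ∃ A B C : Fin 1 → Finset (SeedType s), IsSTPP A B C ∧
    ∀ i, (A i).card = 2 ∧ (B i).card = 2 ∧ (C i).card = 2

/-- The 7 seeds: the abelian groups of exponent `≤ 7`, order `≥ 8`, `≠ 9`, minimal under domination. -/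
def seeds1 : List Seed1 := [⟨[2, 2, 2], exists_isSTPP_222pow1_seed_2_2_2⟩, ⟨[2, 4], exists_isSTPP_222one_seed_2_4⟩, ⟨[2, 2, 3], exists_isSTPP_222one_seed_2_2_3⟩, ⟨[2, 3, 3], exists_isSTPP_222one_seed_2_3_3⟩, ⟨[5, 5], exists_isSTPP_222one_seed_5_5⟩, ⟨[3, 3, 3], exists_isSTPP_222one_seed_3_3_3⟩, ⟨[7, 7], exists_isSTPP_222one_seed_7_7⟩]

/-- The prime powers `≤ 7`. -/
def ppList7 : List ℕ := [2, 4, 3, 5, 7]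

/-- The cap for a prime power `v ≤ 7`: the least `c` with `v ^ c ≥ 10` (capping keeps products `≥ 10`, never creating `9`). -/
def cap10 (v : ℕ) : ℕ := if v = 2 then 4 else if v = 3 then 3 else 2

/-- For a modulus `E`, the prime powers `≤ 7` dividing `E`, each paired with its cap. -/
def capList10 (E : ℕ) : List (ℕ × ℕ) := (ppList7.filter (· ∣ E)).map fun v => (v, cap10 v)

/-- COMBINATORIAL CORE (kernel decision): for every modulus `1 ≤ E ≤ 7`, every sub-multiset of the capping multiset with
product `≥ 8` and `≠ 9` dominates one of the 7 seeds. -/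
theorem dom_of_capped8 : ∀ E ∈ List.range' 1 7, ∀ M ∈ subMS (capList10 E), 8 ≤ M.prod → M.prod ≠ 9 →
    ∃ sd ∈ seeds1, dom sd.s M = true := by
  decide +kernel

/-- The caps are large enough: `v ^ (multiplicity of v in C_E) ≥ 10`. -/
theorem cap10_spec : ∀ E ∈ List.range' 1 7, ∀ v ∈ ppList7, v ∣ E →
    10 ≤ v ^ Multiset.count v (capMS (capList10 E)) := by
  decide +kernel

/-- A prime power `p ^ k ≤ 7` with `k ≥ 1` is one of the listed prime powers. -/
theorem pow_mem_ppList7 {p k : ℕ} (hp : p.Prime) (hk : 0 < k) (h : p ^ k ≤ 7) : p ^ k ∈ ppList7 := by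
  have hp2 := hp.two_le
  have hp7 : p ≤ 7 := le_trans (Nat.le_self_pow hk.ne' p) h
  have hk2 : k ≤ 2 := by
    by_contra hk3
    have h8 : 2 ^ 3 ≤ p ^ k :=
      le_trans (Nat.pow_le_pow_right (by norm_num) (by omega)) (Nat.pow_le_pow_left hp2 k)
    omega
  interval_cases p <;> interval_cases k <;>
    first | decide | (exfalso; revert hp; norm_num; done) | (exfalso; revert h; norm_num)

/-- Elements of `ppList7` are positive. -/
theorem one_le_of_mem_ppList7 {a : ℕ} (h : a ∈ ppList7) : 1 ≤ a := by
  simp only [ppList7, List.mem_cons, List.mem_nil_iff, or_false] at h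
  omega

/-- **Domination for an arbitrary multiset**: prime powers from `ppList7`, all dividing some `1 ≤ E ≤ 7`, product `≥ 8` and
`≠ 9`, dominate one of the 7 seeds. -/
theorem exists_seed1_dom {M : Multiset ℕ} {E : ℕ} (hE1 : 1 ≤ E) (hE7 : E ≤ 7)
    (hpp : ∀ a ∈ M, a ∈ ppList7) (hdvd : ∀ a ∈ M, a ∣ E) (h8 : 8 ≤ M.prod) (h9 : M.prod ≠ 9) :
    ∃ sd ∈ seeds1, dom sd.s M = true := by
  have hEI : E ∈ List.range' 1 7 := List.mem_range'_1.2 ⟨hE1, by omega⟩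
  set C := capMS (capList10 E) with hC
  have hpos : ∀ a ∈ M, 1 ≤ a := fun a ha => one_le_of_mem_ppList7 (hpp a ha)
  have hcap10 : ∀ a ∈ M, 10 ≤ a ^ Multiset.count a C := fun a ha => cap10_spec E hEI a (hpp a ha) (hdvd a ha)
  have hmem : M ∩ C ∈ subMS (capList10 E) := mem_subMS_of_le _ _ Multiset.inter_le_right
  have hge : 8 ≤ (M ∩ C).prod ∧ (M ∩ C).prod ≠ 9 := by
    by_cases h10 : 10 ≤ M.prod
    · have := prod_inter_ge_of (C := C) h10 hpos hcap10
      exact ⟨by omega, by omega⟩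
    · have h8' : 8 ≤ (M ∩ C).prod :=
        prod_inter_ge_of (C := C) h8 hpos (fun a ha => le_trans (by norm_num) (hcap10 a ha))
      have hdv : (M ∩ C).prod ∣ M.prod := Multiset.prod_dvd_prod_of_le Multiset.inter_le_left
      have hle : (M ∩ C).prod ≤ M.prod := Nat.le_of_dvd (by omega) hdv
      exact ⟨h8', by omega⟩
  obtain ⟨sd, hsd, hD⟩ := dom_of_capped8 E hEI (M ∩ C) hmem hge.1 hge.2
  exact ⟨sd, hsd, dom_mono sd.s Multiset.inter_le_left hD⟩

/-! ## 2. The positive half -/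

/-- Transport of the `(2,2,2)¹` statement along an injective additive hom. [cite: CohnKleinbergSzegedyUmans2005, Def. 5.1] -/
theorem exists_isSTPP_222one_of_injective {H K : Type*} [AddCommGroup H] [AddCommGroup K]
    (φ : H →+ K) (hφ : Function.Injective φ)
    (h : ∃ A B C : Fin 1 → Finset H, IsSTPP A B C ∧
      ∀ i, (A i).card = 2 ∧ (B i).card = 2 ∧ (C i).card = 2) :
    ∃ A B C : Fin 1 → Finset K, IsSTPP A B C ∧ ∀ i, (A i).card = 2 ∧ (B i).card = 2 ∧ (C i).card = 2 := by
  classical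
  obtain ⟨A, B, C, hS, hc⟩ := h
  refine ⟨fun i => (A i).image φ, fun i => (B i).image φ, fun i => (C i).image φ, hS.image φ hφ,
    fun i => ?_⟩
  obtain ⟨hA, hB, hC⟩ := hc i
  exact ⟨by rw [card_image_of_injective _ hφ, hA], by rw [card_image_of_injective _ hφ, hB],
    by rw [card_image_of_injective _ hφ, hC]⟩

/-- **The product case.** `Π i, ℤ/(pᵢ^{eᵢ})` admits a TPP triple of 2-subsets as soon as every `pᵢ^{eᵢ}` divides some
`1 ≤ E ≤ 7`, `∏ pᵢ^{eᵢ} ≥ 8` and `≠ 9`. [cite: CohnKleinbergSzegedyUmans2005, Def. 5.1] -/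
theorem exists_isSTPP_222one_pi {ι : Type} [Fintype ι] [DecidableEq ι] (p e : ι → ℕ)
    (hp : ∀ i, (p i).Prime) {E : ℕ} (hE1 : 1 ≤ E) (hE7 : E ≤ 7) (hdvd : ∀ i, p i ^ e i ∣ E)
    (hcard : 8 ≤ ∏ i, p i ^ e i) (h9 : ∏ i, p i ^ e i ≠ 9) :
    ∃ A B C : Fin 1 → Finset (Π i, ZMod (p i ^ e i)), IsSTPP A B C ∧
      ∀ i, (A i).card = 2 ∧ (B i).card = 2 ∧ (C i).card = 2 := by
  have hq0 : ∀ i, p i ^ e i ≠ 0 := fun i => pow_ne_zero _ (hp i).ne_zero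
  have hprodeq : ((Finset.univ.filter fun i => 0 < e i).val.map fun i => p i ^ e i).prod = ∏ i, p i ^ e i := by
    rw [← Finset.prod_eq_multiset_prod]
    exact Finset.prod_filter_of_ne fun i _ hi => Nat.pos_of_ne_zero fun h0 => hi (by rw [h0, pow_zero])
  have hmem : ∀ a ∈ ((Finset.univ.filter fun i => 0 < e i).val.map fun i => p i ^ e i),
      a ∈ ppList7 ∧ a ∣ E := by
    intro a ha
    obtain ⟨i, hi, rfl⟩ := Multiset.mem_map.1 ha
    have hi' : 0 < e i := (Finset.mem_filter.1 hi).2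
    exact ⟨pow_mem_ppList7 (hp i) hi' (le_trans (Nat.le_of_dvd (by omega) (hdvd i)) hE7), hdvd i⟩
  obtain ⟨sd, -, hD⟩ :=
    exists_seed1_dom hE1 hE7 (fun a ha => (hmem a ha).1) (fun a ha => (hmem a ha).2)
      (by rw [hprodeq]; exact hcard) (by rw [hprodeq]; exact h9)
  obtain ⟨φ, hφ, -⟩ := exists_emb_of_dom (fun i => p i ^ e i) hq0 sd.s _ hD
  exact exists_isSTPP_222one_of_injective φ hφ sd.ok

/-- **Every finite abelian group of order `≥ 8` and `≠ 9` admits a TPP triple of 2-subsets** (CKSU Def. 5.1 with one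
triple, tree form `IsSTPP` over `Fin 1`). [cite: CohnKleinbergSzegedyUmans2005, Def. 5.1] -/
theorem exists_isSTPP_222one_of_card_ne {G : Type*} [AddCommGroup G] [Finite G] (hG : 8 ≤ Nat.card G)
    (h9 : Nat.card G ≠ 9) :
    ∃ A B C : Fin 1 → Finset G, IsSTPP A B C ∧ ∀ i, (A i).card = 2 ∧ (B i).card = 2 ∧ (C i).card = 2 := by
  classical
  by_cases hexp : 8 ≤ AddMonoid.exponent G
  · exact exists_isSTPP_222pow_of_exponent 1 (by norm_num; exact hexp)
  obtain ⟨ι, _, p, hp, e, ⟨g⟩⟩ := AddCommGroup.equiv_directSum_zmod_of_finite G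
  let f : G ≃+ (Π i, ZMod (p i ^ e i)) :=
    g.trans (DirectSum.linearEquivFunOnFintype ℕ ι (fun i => ZMod (p i ^ e i))).toAddEquiv
  have hE1 : 1 ≤ AddMonoid.exponent G := Nat.pos_of_ne_zero AddMonoid.exponent_ne_zero_of_finite
  have hdvd : ∀ i, p i ^ e i ∣ AddMonoid.exponent G := fun i => by
    have hinj : Function.Injective (AddMonoidHom.single (fun j => ZMod (p j ^ e j)) i) :=
      Pi.single_injective (M := fun j => ZMod (p j ^ e j)) i
    have h1 : addOrderOf (f.symm (AddMonoidHom.single (fun j => ZMod (p j ^ e j)) i 1)) = p i ^ e i := by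
      rw [AddEquiv.addOrderOf_eq, addOrderOf_injective _ hinj, ZMod.addOrderOf_one]
    rw [← h1]
    exact AddMonoid.addOrder_dvd_exponent _
  have hcardeq : Nat.card G = ∏ i, p i ^ e i := by
    rw [Nat.card_congr f.toEquiv, Nat.card_pi]
    simp [Nat.card_zmod]
  have h := exists_isSTPP_222one_pi p e hp hE1 (by omega) hdvd (by rw [← hcardeq]; exact hG)
    (by rw [← hcardeq]; exact h9)
  exact exists_isSTPP_222one_of_injective f.symm.toAddMonoidHom f.symm.injective h

/-- `ℤ/9` admits a TPP triple of 2-subsets (the cyclic family of `STPP222PowCyclic.lean` at `k = 1`).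
[cite: CohnKleinbergSzegedyUmans2005, Def. 5.1] -/
theorem exists_isSTPP_222one_zmod9 :
    ∃ A B C : Fin 1 → Finset (ZMod 9), IsSTPP A B C ∧ ∀ i, (A i).card = 2 ∧ (B i).card = 2 ∧ (C i).card = 2 :=
  exists_isSTPP_222pow_zmod 1 9 (by norm_num)

/-- **Every finite abelian group of order `≥ 10` admits a TPP triple of 2-subsets** (`N₁ ≤ 10`).
[cite: CohnKleinbergSzegedyUmans2005, Def. 5.1] -/
theorem exists_isSTPP_222one_of_card {G : Type*} [AddCommGroup G] [Finite G] (hG : 10 ≤ Nat.card G) :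
    ∃ A B C : Fin 1 → Finset G, IsSTPP A B C ∧ ∀ i, (A i).card = 2 ∧ (B i).card = 2 ∧ (C i).card = 2 :=
  exists_isSTPP_222one_of_card_ne (by omega) (by omega)

/-! ## 3. The negative half (kernel) -/

/-- No finite abelian group of order `< 8` admits a TPP triple of 2-subsets: `|A||B||C| ≤ |G|`
(`stpp_card_mul_card_mul_card_le`). [cite: CohnUmans2003, Lemma 2.x (abelian pseudo-exponent 3)] -/
theorem not_exists_isSTPP_222one_of_card_lt {G : Type*} [AddCommGroup G] [Fintype G] (hG : Fintype.card G < 8) :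
    ¬ ∃ A B C : Fin 1 → Finset G, IsSTPP A B C ∧ ∀ i, (A i).card = 2 ∧ (B i).card = 2 ∧ (C i).card = 2 := by
  rintro ⟨A, B, C, hS, hc⟩
  obtain ⟨hA, hB, hC⟩ := hc 0
  have h := stpp_card_mul_card_mul_card_le hS 0
  rw [hA, hB, hC] at h
  omega

/-- The difference computation behind `(ℤ/3)²` (kernel decision, `8³ · 64` cases): for all nonzero `a b c ∈ (ℤ/3)²` there
is a choice of "which element" bits `(ε₁, ε₁', ε₂, ε₂', ε₃, ε₃')`, not pairwise equal, such that with `s = ε₁·a`, `s' = ε₁'·a`,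
`t = ε₂·b`, `t' = ε₂'·b`, `u = ε₃·c`, `u' = ε₃'·c` the Def-5.1 word `(s' − s) + (t' − t) + (u' − u)` vanishes. -/
theorem z3z3_diff_witness : ∀ a b c : ZMod 3 × ZMod 3, a ≠ 0 → b ≠ 0 → c ≠ 0 →
    ∃ e : Bool × Bool × Bool × Bool × Bool × Bool,
      ((bif e.2.1 then a else 0) - (bif e.1 then a else 0)) +
        ((bif e.2.2.2.1 then b else 0) - (bif e.2.2.1 then b else 0)) +
        ((bif e.2.2.2.2.2 then c else 0) - (bif e.2.2.2.2.1 then c else 0)) = 0 ∧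
      ¬ (e.1 = e.2.1 ∧ e.2.2.1 = e.2.2.2.1 ∧ e.2.2.2.2.1 = e.2.2.2.2.2) := by
  decide +kernel

/-- **`ℤ/3 × ℤ/3` admits no TPP triple of 2-subsets** (kernel): writing the three 2-sets as `{a₁,a₂}, {b₁,b₂}, {c₁,c₂}`, the
difference vectors `a₂−a₁, b₂−b₁, c₂−c₁` are nonzero and `z3z3_diff_witness` produces a nontrivial vanishing word, contradicting
`IsSTPP` at the index pattern `(0,0,0)`.  (Every abelian group of order `9` and exponent `3` is isomorphic to `(ℤ/3)²`.)
[cite: CohnKleinbergSzegedyUmans2005, Def. 5.1] -/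
theorem not_exists_isSTPP_222one_z3z3 :
    ¬ ∃ A B C : Fin 1 → Finset (ZMod 3 × ZMod 3), IsSTPP A B C ∧
      ∀ i, (A i).card = 2 ∧ (B i).card = 2 ∧ (C i).card = 2 := by
  rintro ⟨A, B, C, hS, hc⟩
  obtain ⟨hA, hB, hC⟩ := hc 0
  obtain ⟨a₁, a₂, ha, hAe⟩ := Finset.card_eq_two.1 hA
  obtain ⟨b₁, b₂, hb, hBe⟩ := Finset.card_eq_two.1 hB
  obtain ⟨c₁, c₂, hcne, hCe⟩ := Finset.card_eq_two.1 hC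
  have ha' : a₂ - a₁ ≠ 0 := sub_ne_zero.2 (Ne.symm ha)
  have hb' : b₂ - b₁ ≠ 0 := sub_ne_zero.2 (Ne.symm hb)
  have hc' : c₂ - c₁ ≠ 0 := sub_ne_zero.2 (Ne.symm hcne)
  obtain ⟨⟨ε₁, ε₁', ε₂, ε₂', ε₃, ε₃'⟩, hrel, hne⟩ := z3z3_diff_witness _ _ _ ha' hb' hc'
  simp only at hrel hne
  -- the chosen elements, translated back into the three sets
  have memA : ∀ β : Bool, (bif β then a₂ - a₁ else 0) + a₁ ∈ A 0 := by
    intro β; rw [hAe]; cases β <;> simp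
  have memB : ∀ β : Bool, (bif β then b₂ - b₁ else 0) + b₁ ∈ B 0 := by
    intro β; rw [hBe]; cases β <;> simp
  have memC : ∀ β : Bool, (bif β then c₂ - c₁ else 0) + c₁ ∈ C 0 := by
    intro β; rw [hCe]; cases β <;> simp
  have hrel' : (((bif ε₁' then a₂ - a₁ else 0) + a₁) - ((bif ε₁ then a₂ - a₁ else 0) + a₁)) +
      (((bif ε₂' then b₂ - b₁ else 0) + b₁) - ((bif ε₂ then b₂ - b₁ else 0) + b₁)) +
      (((bif ε₃' then c₂ - c₁ else 0) + c₁) - ((bif ε₃ then c₂ - c₁ else 0) + c₁)) = 0 := by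
    have e : (((bif ε₁' then a₂ - a₁ else 0) + a₁) - ((bif ε₁ then a₂ - a₁ else 0) + a₁)) +
        (((bif ε₂' then b₂ - b₁ else 0) + b₁) - ((bif ε₂ then b₂ - b₁ else 0) + b₁)) +
        (((bif ε₃' then c₂ - c₁ else 0) + c₁) - ((bif ε₃ then c₂ - c₁ else 0) + c₁)) =
        ((bif ε₁' then a₂ - a₁ else 0) - (bif ε₁ then a₂ - a₁ else 0)) +
        ((bif ε₂' then b₂ - b₁ else 0) - (bif ε₂ then b₂ - b₁ else 0)) +
        ((bif ε₃' then c₂ - c₁ else 0) - (bif ε₃ then c₂ - c₁ else 0)) := by abel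
    rw [e]; exact hrel
  obtain ⟨-, -, h1, h2, h3⟩ := hS 0 0 0 _ (memA ε₁) _ (memA ε₁') _ (memB ε₂) _ (memB ε₂') _ (memC ε₃) _ (memC ε₃') hrel'
  have e1 : ε₁ = ε₁' := by
    have h := add_right_cancel h1
    cases ε₁ <;> cases ε₁' <;> simp_all
  have e2 : ε₂ = ε₂' := by
    have h := add_right_cancel h2
    cases ε₂ <;> cases ε₂' <;> simp_all
  have e3 : ε₃ = ε₃' := by
    have h := add_right_cancel h3
    cases ε₃ <;> cases ε₃' <;> simp_all
  exact hne ⟨e1, e2, e3⟩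

end Summit.MatrixMultiplication.OmegaCensus
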